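import Mathlib
import HarnessLib
import Literature.Computability.AlgebraicComplexity.RealTauKnownCases
import Summits.ValiantsHypothesis.ValiantsHypothesis.Theorems.LacunarySymmetroidMatrixDescartesOsculationLawGPArcSheets
import Summits.ValiantsHypothesis.ValiantsHypothesis.Theorems.LacunarySymmetroidMatrixDescartesOsculationLawCuspNonMonicCount

/-!
# ValiantsHypothesis / LacunarySymmetroid — crux `MatrixDescartes` (stmt-ValiantsHypothesis-18050, V1),
# line `Cruxes/MatrixDescartes/Lines/osculation_law.lean` («osculation-law»): the COMMUTING / DIAGONAL column,
# part 1 — PRODUCTS OF SHEETS (NOTE-p7g13 §11 (2) made kernel-checkable)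

When the letters of a symmetric lacunary pencil COMMUTE, the insertion curve at the full-rank splitting is a product
of rank-one SHEETS `L_i = X₁ + ι(g_i)` (`ι : t ↦ X₀`), one per eigenvalue branch `b = −g_i(t)`, each `g_i` a fewnomial
on the common exponent set `E` (`|E| ≤ K`).  For such a product `Φ = ∏_i L_i` the osculation-type set
`O = {(t,b) : t > 0, b > 0, Φ = 0, H(Φ) = 0}` (`H` = the bordered log-Hessian of the line, unfolded) is, WHEN FINITE,
small:

* a point of `O` on exactly one sheet `i` is `(t, −g_i(t))` with `t` a positive root of the log-Wronskian
  `W(g_i) = g_i·θ²g_i − (θg_i)²` (`θ = t·d/dt`; by `OsculationGeneric.logHessian_sheet` and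
  `eval_logHessian_mul_of_eval_eq_zero`), whose support has at most `C(|E|,2)` exponents (`card_support_logWronskian_le`);
* a point on two sheets `i ≠ j` has `t` a positive root of the `|E|`-nomial `g_i − g_j`;
* the degenerate cases (`W(g_i) ≡ 0`, or `g_i ≡ g_j`) put a whole open arc of the (visible) sheet into `O`, so they are
  excluded by FINITENESS alone — no general-position hypothesis is needed.

Hence, by Descartes' bound `#{positive roots} ≤ #support − 1`
(`Literature.Computability.AlgebraicComplexity.card_roots_toFinset_filter_pos_lt_card_support`):

  **`sheetProduct_count`**: `O.Finite → O.ncard ≤ r·(C(|E|,2) − 1) + C(r,2)·(|E| − 1)`.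

Part 2 (`…OsculationLawCommutingDiagonal`) applies this to DIAGONAL letters at every splitting `(r,s)`; part 3 to
pairwise-commuting symmetric letters at the splitting `(m,0)`.

Honest framing: a RESTRICTED-CLASS column (commuting letters; polynomial bound `≤ (m²K + mK²)/2`).  It is NOT the
line's `stub_osculationLaw` (the LAW, all symmetric pencils, `2^(C(K+log² m))`), not `MatrixDescartes`, not
Conjecture B; `VP ≠ VNP` is NOT proved.  No definitions, no named facts; Mathlib + tree files by name.
-/

-- `Summit.ValiantsHypothesis.ValiantsHypothesis.…` is the tree's mandated single-conjunct layout (Sub = Summit).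
set_option linter.dupNamespace false

noncomputable section

namespace Summit.ValiantsHypothesis.ValiantsHypothesis.Theorems.LacunarySymmetroidMatrixDescartes

namespace OsculationCommuting

open Polynomial
open scoped BigOperators

/-! ### Fewnomial bookkeeping: supports of `θg`, `θ²g`, `W(g)` and `g_i − g_j` -/

/-- A polynomial with support inside `E` is the sum of its monomials over `E`. [folklore] -/
theorem eq_sum_C_mul_X_pow_of_support_subset {g : ℝ[X]} {E : Finset ℕ} (hE : g.support ⊆ E) :
    g = ∑ e ∈ E, C (g.coeff e) * X ^ e := by
  conv_lhs => rw [g.as_sum_support_C_mul_X_pow]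
  refine Finset.sum_subset hE fun e _ he => ?_
  rw [Polynomial.notMem_support_iff.1 he, map_zero, zero_mul]

/-- `θ(Σ a_e X^e) = Σ e·a_e X^e`. [folklore] -/
theorem euler_sum (E : Finset ℕ) (a : ℕ → ℝ) :
    X * derivative (∑ e ∈ E, C (a e) * X ^ e) = ∑ e ∈ E, C (a e * e) * X ^ e := by
  rw [derivative_sum, Finset.mul_sum]
  refine Finset.sum_congr rfl fun e _ => ?_
  rw [derivative_C_mul_X_pow, map_mul, Polynomial.C_eq_natCast]
  rcases Nat.eq_zero_or_pos e with rfl | he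
  · simp
  · obtain ⟨k, rfl⟩ : ∃ k, e = k + 1 := ⟨e - 1, by omega⟩
    rw [Nat.add_sub_cancel, pow_succ']
    ring

/-- **The log-Wronskian of a fewnomial**: `W(g) = g·θ²g − (θg)² = Σ_{e,e'} a_e a_{e'} e'(e'−e) X^(e+e')`. [folklore] -/
theorem logWronskian_sum (E : Finset ℕ) (a : ℕ → ℝ) :
    (∑ e ∈ E, C (a e) * X ^ e) * (X * derivative (X * derivative (∑ e ∈ E, C (a e) * X ^ e)))
        - (X * derivative (∑ e ∈ E, C (a e) * X ^ e)) ^ 2 =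
      ∑ p ∈ (E ×ˢ E : Finset (ℕ × ℕ)), C (a p.1 * a p.2 * ((p.2 : ℝ) * ((p.2 : ℝ) - (p.1 : ℝ)))) * (X : ℝ[X]) ^ (p.1 + p.2) := by
  have h1 : X * derivative (∑ e ∈ E, C (a e) * X ^ e) = ∑ e ∈ E, C (a e * e) * X ^ e := euler_sum E a
  have h2 : X * derivative (X * derivative (∑ e ∈ E, C (a e) * X ^ e)) = ∑ e ∈ E, C (a e * e * e) * X ^ e := by
    rw [h1]; exact euler_sum E (fun e => a e * e)
  rw [h2, h1, sq, Finset.sum_mul_sum, Finset.sum_mul_sum, Finset.sum_product, ← Finset.sum_sub_distrib]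
  refine Finset.sum_congr rfl fun e _ => ?_
  rw [← Finset.sum_sub_distrib]
  refine Finset.sum_congr rfl fun e' _ => ?_
  simp only [map_mul, map_sub, map_natCast, pow_add]
  ring

/-- The support of `W(g)` sits over the 2-subsets of `E`: the diagonal terms `e = e'` vanish and `(e,e')`, `(e',e)`
carry the same exponent. [folklore] -/
theorem support_logWronskian_subset {g : ℝ[X]} {E : Finset ℕ} (hE : g.support ⊆ E) :
    (g * (X * derivative (X * derivative g)) - (X * derivative g) ^ 2).support ⊆
      (E.powersetCard 2).image (fun s => ∑ x ∈ s, x) := by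
  classical
  intro n hn
  rw [eq_sum_C_mul_X_pow_of_support_subset hE, logWronskian_sum, mem_support_iff, finsetSum_coeff] at hn
  simp only [coeff_C_mul, coeff_X_pow, mul_ite, mul_one, mul_zero] at hn
  -- some off-diagonal pair `(e, e')` with `e + e' = n` must exist
  by_contra hne
  apply hn
  refine Finset.sum_eq_zero fun p hp => ?_
  split_ifs with h
  · rcases eq_or_ne p.1 p.2 with hd | hd
    · rw [hd, sub_self, mul_zero, mul_zero]
    · exfalso
      apply hne
      rw [Finset.mem_image]
      refine ⟨{p.1, p.2}, ?_, ?_⟩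
      · rw [Finset.mem_powersetCard]
        refine ⟨?_, Finset.card_pair hd⟩
        intro x hx
        rw [Finset.mem_insert, Finset.mem_singleton] at hx
        rcases hx with rfl | rfl
        · exact (Finset.mem_product.1 hp).1
        · exact (Finset.mem_product.1 hp).2
      · rw [Finset.sum_pair hd, h]
  · rfl

/-- `|supp W(g)| ≤ C(|E|, 2)`. [folklore] -/
theorem card_support_logWronskian_le {g : ℝ[X]} {E : Finset ℕ} (hE : g.support ⊆ E) :
    (g * (X * derivative (X * derivative g)) - (X * derivative g) ^ 2).support.card ≤ E.card.choose 2 :=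
  (Finset.card_le_card (support_logWronskian_subset hE)).trans
    (Finset.card_image_le.trans (Finset.card_powersetCard 2 E).le)

/-- `|supp (g − g')| ≤ |E|`. [folklore] -/
theorem card_support_sub_le {g g' : ℝ[X]} {E : Finset ℕ} (hE : g.support ⊆ E) (hE' : g'.support ⊆ E) :
    (g - g').support.card ≤ E.card := by
  refine Finset.card_le_card fun n hn => ?_
  rw [mem_support_iff, coeff_sub] at hn
  by_contra h
  have h1 : g.coeff n = 0 := Polynomial.notMem_support_iff.1 fun h' => h (hE h')
  have h2 : g'.coeff n = 0 := Polynomial.notMem_support_iff.1 fun h' => h (hE' h')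
  exact hn (by rw [h1, h2, sub_zero])

/-- Descartes: a nonzero real polynomial has at most `#support − 1` distinct positive roots (tree
`Literature.…card_roots_toFinset_filter_pos_lt_card_support`). [folklore] -/
theorem card_posRoots_le {P : ℝ[X]} (hP : P ≠ 0) :
    (P.roots.toFinset.filter (fun t => 0 < t)).card ≤ P.support.card - 1 := by
  have := Literature.Computability.AlgebraicComplexity.card_roots_toFinset_filter_pos_lt_card_support hP
  omega


/-! ### Sheets `L = X₁ + ι(g)` and their evaluation -/

/-- Evaluation of a sheet: `L(t,b) = b + g(t)`. [folklore] -/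
theorem eval_sheet (g : ℝ[X]) (p : Fin 2 → ℝ) :
    MvPolynomial.eval p (MvPolynomial.X 1 + Polynomial.aeval (MvPolynomial.X 0 : MvPolynomial (Fin 2) ℝ) g) = p 1 + g.eval (p 0) := by
  rw [map_add, MvPolynomial.eval_X, OsculationRankOne.eval_aevalX0]

/-- Evaluation of the bordered log-Hessian of a sheet: `H(L)(t,b) = b·(b·θ²g(t) + θg(t)²)`
(`OsculationGeneric.logHessian_sheet` with `α = 1`). [folklore] -/
theorem eval_logHessian_sheet (g : ℝ[X]) (p : Fin 2 → ℝ) :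
    MvPolynomial.eval p
        (MvPolynomial.X 0 * MvPolynomial.pderiv 0 (MvPolynomial.X 0 * MvPolynomial.pderiv 0 (MvPolynomial.X 1 + Polynomial.aeval (MvPolynomial.X 0 : MvPolynomial (Fin 2) ℝ) g)) * (MvPolynomial.X 1 * MvPolynomial.pderiv 1 (MvPolynomial.X 1 + Polynomial.aeval (MvPolynomial.X 0 : MvPolynomial (Fin 2) ℝ) g)) ^ 2
          - 2 * (MvPolynomial.X 0 * MvPolynomial.pderiv 0 (MvPolynomial.X 1 * MvPolynomial.pderiv 1 (MvPolynomial.X 1 + Polynomial.aeval (MvPolynomial.X 0 : MvPolynomial (Fin 2) ℝ) g)))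
            * (MvPolynomial.X 0 * MvPolynomial.pderiv 0 (MvPolynomial.X 1 + Polynomial.aeval (MvPolynomial.X 0 : MvPolynomial (Fin 2) ℝ) g)) * (MvPolynomial.X 1 * MvPolynomial.pderiv 1 (MvPolynomial.X 1 + Polynomial.aeval (MvPolynomial.X 0 : MvPolynomial (Fin 2) ℝ) g))
          + MvPolynomial.X 1 * MvPolynomial.pderiv 1 (MvPolynomial.X 1 * MvPolynomial.pderiv 1 (MvPolynomial.X 1 + Polynomial.aeval (MvPolynomial.X 0 : MvPolynomial (Fin 2) ℝ) g)) * (MvPolynomial.X 0 * MvPolynomial.pderiv 0 (MvPolynomial.X 1 + Polynomial.aeval (MvPolynomial.X 0 : MvPolynomial (Fin 2) ℝ) g)) ^ 2) =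
      p 1 * (p 1 * (X * derivative (X * derivative g)).eval (p 0) + ((X * derivative g).eval (p 0)) ^ 2) := by
  have hform : (MvPolynomial.X 1 + Polynomial.aeval (MvPolynomial.X 0 : MvPolynomial (Fin 2) ℝ) g) =
      MvPolynomial.C 1 * MvPolynomial.X 1 + Polynomial.aeval (MvPolynomial.X 0 : MvPolynomial (Fin 2) ℝ) g := by rw [map_one, one_mul]
  rw [hform, OsculationGeneric.logHessian_sheet]
  simp only [map_mul, map_add, map_pow, MvPolynomial.eval_C, MvPolynomial.eval_X, OsculationRankOne.eval_aevalX0, one_mul,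
    eval_mul, eval_X]

/-- On the sheet (`b = −g(t)`), `H(L) = 0` with `b ≠ 0` says that `t` is a root of the log-Wronskian
`W(g) = g·θ²g − (θg)²`. [folklore] -/
theorem logWronskian_root_of_sheet (g : ℝ[X]) (p : Fin 2 → ℝ) (hb : p 1 ≠ 0) (hL : p 1 + g.eval (p 0) = 0)
    (hH : MvPolynomial.eval p
        (MvPolynomial.X 0 * MvPolynomial.pderiv 0 (MvPolynomial.X 0 * MvPolynomial.pderiv 0 (MvPolynomial.X 1 + Polynomial.aeval (MvPolynomial.X 0 : MvPolynomial (Fin 2) ℝ) g)) * (MvPolynomial.X 1 * MvPolynomial.pderiv 1 (MvPolynomial.X 1 + Polynomial.aeval (MvPolynomial.X 0 : MvPolynomial (Fin 2) ℝ) g)) ^ 2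
          - 2 * (MvPolynomial.X 0 * MvPolynomial.pderiv 0 (MvPolynomial.X 1 * MvPolynomial.pderiv 1 (MvPolynomial.X 1 + Polynomial.aeval (MvPolynomial.X 0 : MvPolynomial (Fin 2) ℝ) g)))
            * (MvPolynomial.X 0 * MvPolynomial.pderiv 0 (MvPolynomial.X 1 + Polynomial.aeval (MvPolynomial.X 0 : MvPolynomial (Fin 2) ℝ) g)) * (MvPolynomial.X 1 * MvPolynomial.pderiv 1 (MvPolynomial.X 1 + Polynomial.aeval (MvPolynomial.X 0 : MvPolynomial (Fin 2) ℝ) g))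
          + MvPolynomial.X 1 * MvPolynomial.pderiv 1 (MvPolynomial.X 1 * MvPolynomial.pderiv 1 (MvPolynomial.X 1 + Polynomial.aeval (MvPolynomial.X 0 : MvPolynomial (Fin 2) ℝ) g))
            * (MvPolynomial.X 0 * MvPolynomial.pderiv 0 (MvPolynomial.X 1 + Polynomial.aeval (MvPolynomial.X 0 : MvPolynomial (Fin 2) ℝ) g)) ^ 2) = 0) :
    (g * (X * derivative (X * derivative g)) - (X * derivative g) ^ 2).eval (p 0) = 0 := by
  rw [eval_logHessian_sheet] at hH
  have h1 : p 1 * (X * derivative (X * derivative g)).eval (p 0) + ((X * derivative g).eval (p 0)) ^ 2 = 0 :=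
    (mul_eq_zero.1 hH).resolve_left hb
  have hg : g.eval (p 0) = -p 1 := by linarith
  rw [eval_sub, eval_mul, eval_pow, hg]
  linarith

/-- Conversely, if `W(g)(t) = 0` then `H(L)` vanishes at the sheet point over `t`. [folklore] -/
theorem eval_logHessian_sheet_eq_zero_of_logWronskian (g : ℝ[X]) (p : Fin 2 → ℝ) (hL : p 1 + g.eval (p 0) = 0)
    (hW : (g * (X * derivative (X * derivative g)) - (X * derivative g) ^ 2).eval (p 0) = 0) :
    MvPolynomial.eval p
        (MvPolynomial.X 0 * MvPolynomial.pderiv 0 (MvPolynomial.X 0 * MvPolynomial.pderiv 0 (MvPolynomial.X 1 + Polynomial.aeval (MvPolynomial.X 0 : MvPolynomial (Fin 2) ℝ) g)) * (MvPolynomial.X 1 * MvPolynomial.pderiv 1 (MvPolynomial.X 1 + Polynomial.aeval (MvPolynomial.X 0 : MvPolynomial (Fin 2) ℝ) g)) ^ 2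
          - 2 * (MvPolynomial.X 0 * MvPolynomial.pderiv 0 (MvPolynomial.X 1 * MvPolynomial.pderiv 1 (MvPolynomial.X 1 + Polynomial.aeval (MvPolynomial.X 0 : MvPolynomial (Fin 2) ℝ) g)))
            * (MvPolynomial.X 0 * MvPolynomial.pderiv 0 (MvPolynomial.X 1 + Polynomial.aeval (MvPolynomial.X 0 : MvPolynomial (Fin 2) ℝ) g)) * (MvPolynomial.X 1 * MvPolynomial.pderiv 1 (MvPolynomial.X 1 + Polynomial.aeval (MvPolynomial.X 0 : MvPolynomial (Fin 2) ℝ) g))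
          + MvPolynomial.X 1 * MvPolynomial.pderiv 1 (MvPolynomial.X 1 * MvPolynomial.pderiv 1 (MvPolynomial.X 1 + Polynomial.aeval (MvPolynomial.X 0 : MvPolynomial (Fin 2) ℝ) g)) * (MvPolynomial.X 0 * MvPolynomial.pderiv 0 (MvPolynomial.X 1 + Polynomial.aeval (MvPolynomial.X 0 : MvPolynomial (Fin 2) ℝ) g)) ^ 2) = 0 := by
  rw [eval_logHessian_sheet]
  have hg : g.eval (p 0) = -p 1 := by linarith
  rw [eval_sub, eval_mul, eval_pow, hg] at hW
  have : p 1 * (X * derivative (X * derivative g)).eval (p 0) + ((X * derivative g).eval (p 0)) ^ 2 = 0 := by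
    linarith
  rw [this, mul_zero]

/-! ### An open arc of a visible sheet is infinite -/

/-- If every point `(t, −g(t))` of the sheet with `t > 0`, `g(t) < 0` belongs to a set `O`, and the sheet is
visible (`g(t₀) < 0` for some `t₀ > 0`), then `O` is infinite. [folklore] -/
theorem infinite_of_sheet_subset {O : Set (Fin 2 → ℝ)} (g : ℝ[X]) (t₀ : ℝ) (ht₀ : 0 < t₀) (hg : g.eval t₀ < 0)
    (h : ∀ t : ℝ, 0 < t → g.eval t < 0 → (![t, -g.eval t] : Fin 2 → ℝ) ∈ O) : O.Infinite := by
  have hopen : IsOpen {t : ℝ | 0 < t ∧ g.eval t < 0} :=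
    (isOpen_lt continuous_const continuous_id).inter (isOpen_lt (Polynomial.continuous g) continuous_const)
  obtain ⟨ε, hε, hball⟩ := Metric.isOpen_iff.1 hopen t₀ ⟨ht₀, hg⟩
  rw [Real.ball_eq_Ioo] at hball
  refine Set.infinite_of_injOn_mapsTo (f := fun t : ℝ => (![t, -g.eval t] : Fin 2 → ℝ))
    (s := Set.Ioo (t₀ - ε) (t₀ + ε)) ?_ (fun t ht => h t (hball ht).1 (hball ht).2) (Set.Ioo_infinite (by linarith))
  intro t _ t' _ htt'
  have := congr_fun htt' 0
  simpa using this

/-! ### The count for a product of sheets -/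

/-- `Σ_i #{j : i < j} = C(r,2)` on `Fin r`. [folklore] -/
theorem sum_card_Ioi_fin (r : ℕ) : ∑ i : Fin r, (Finset.Ioi i).card = r.choose 2 := by
  have h1 : ∑ i : Fin r, (Finset.Ioi i).card = ∑ i ∈ Finset.range r, (r - 1 - i) := by
    rw [← Fin.sum_univ_eq_sum_range (fun i => r - 1 - i)]
    exact Finset.sum_congr rfl fun i _ => Fin.card_Ioi i
  rw [h1, Finset.sum_range_reflect (fun i => i) r, Nat.choose_two_right]
  have := Finset.sum_range_id_mul_two r
  omega

set_option maxHeartbeats 800000 in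
/-- **The osculation count for a product of sheets.**  `Φ = ∏_{i<r} (X₁ + ι(g_i))` with every `supp g_i ⊆ E`:
if the osculation-type set `O = {(t,b) : t > 0, b > 0, Φ = 0, H(Φ) = 0}` is finite then
`#O ≤ r·(C(|E|,2) − 1) + C(r,2)·(|E| − 1)`.  (NOTE-p7g13 §11 (2): the COMMUTING skeleton of the osculation law is
polynomial.) [folklore] -/
theorem sheetProduct_count {r : ℕ} (E : Finset ℕ) (g : Fin r → ℝ[X]) (hE : ∀ i, (g i).support ⊆ E)
    (Φ : MvPolynomial (Fin 2) ℝ)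
    (hΦ : Φ = ∏ i, (MvPolynomial.X 1 + Polynomial.aeval (MvPolynomial.X 0 : MvPolynomial (Fin 2) ℝ) (g i)))
    (hfin : {p : Fin 2 → ℝ | 0 < p 0 ∧ 0 < p 1 ∧ MvPolynomial.eval p Φ = 0 ∧
      MvPolynomial.eval p
        (MvPolynomial.X 0 * MvPolynomial.pderiv 0 (MvPolynomial.X 0 * MvPolynomial.pderiv 0 (Φ)) * (MvPolynomial.X 1 * MvPolynomial.pderiv 1 (Φ)) ^ 2
          - 2 * (MvPolynomial.X 0 * MvPolynomial.pderiv 0 (MvPolynomial.X 1 * MvPolynomial.pderiv 1 (Φ)))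
            * (MvPolynomial.X 0 * MvPolynomial.pderiv 0 (Φ)) * (MvPolynomial.X 1 * MvPolynomial.pderiv 1 (Φ))
          + MvPolynomial.X 1 * MvPolynomial.pderiv 1 (MvPolynomial.X 1 * MvPolynomial.pderiv 1 (Φ)) * (MvPolynomial.X 0 * MvPolynomial.pderiv 0 (Φ)) ^ 2) = 0}.Finite) :
    {p : Fin 2 → ℝ | 0 < p 0 ∧ 0 < p 1 ∧ MvPolynomial.eval p Φ = 0 ∧
      MvPolynomial.eval p
        (MvPolynomial.X 0 * MvPolynomial.pderiv 0 (MvPolynomial.X 0 * MvPolynomial.pderiv 0 (Φ)) * (MvPolynomial.X 1 * MvPolynomial.pderiv 1 (Φ)) ^ 2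
          - 2 * (MvPolynomial.X 0 * MvPolynomial.pderiv 0 (MvPolynomial.X 1 * MvPolynomial.pderiv 1 (Φ)))
            * (MvPolynomial.X 0 * MvPolynomial.pderiv 0 (Φ)) * (MvPolynomial.X 1 * MvPolynomial.pderiv 1 (Φ))
          + MvPolynomial.X 1 * MvPolynomial.pderiv 1 (MvPolynomial.X 1 * MvPolynomial.pderiv 1 (Φ)) * (MvPolynomial.X 0 * MvPolynomial.pderiv 0 (Φ)) ^ 2) = 0}.ncard ≤
      r * (E.card.choose 2 - 1) + r.choose 2 * (E.card - 1) := by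
  classical
  set O := {p : Fin 2 → ℝ | 0 < p 0 ∧ 0 < p 1 ∧ MvPolynomial.eval p Φ = 0 ∧
      MvPolynomial.eval p
        (MvPolynomial.X 0 * MvPolynomial.pderiv 0 (MvPolynomial.X 0 * MvPolynomial.pderiv 0 (Φ)) * (MvPolynomial.X 1 * MvPolynomial.pderiv 1 (Φ)) ^ 2
          - 2 * (MvPolynomial.X 0 * MvPolynomial.pderiv 0 (MvPolynomial.X 1 * MvPolynomial.pderiv 1 (Φ)))
            * (MvPolynomial.X 0 * MvPolynomial.pderiv 0 (Φ)) * (MvPolynomial.X 1 * MvPolynomial.pderiv 1 (Φ))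
          + MvPolynomial.X 1 * MvPolynomial.pderiv 1 (MvPolynomial.X 1 * MvPolynomial.pderiv 1 (Φ)) * (MvPolynomial.X 0 * MvPolynomial.pderiv 0 (Φ)) ^ 2) = 0} with hO
  -- the sheets
  set L : Fin r → MvPolynomial (Fin 2) ℝ := fun i => MvPolynomial.X 1 + Polynomial.aeval (MvPolynomial.X 0 : MvPolynomial (Fin 2) ℝ) (g i) with hL
  have hΦL : Φ = ∏ i, L i := hΦ
  have hevalL : ∀ i (p : Fin 2 → ℝ), MvPolynomial.eval p (L i) = p 1 + (g i).eval (p 0) := fun i p => eval_sheet (g i) p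
  -- splitting off one sheet
  have hsplit : ∀ i, Φ = L i * ∏ j ∈ Finset.univ.erase i, L j := fun i => by
    rw [hΦL, Finset.mul_prod_erase _ _ (Finset.mem_univ i)]
  -- evaluation of `Φ` vanishes on every sheet
  have hevalΦ : ∀ i (p : Fin 2 → ℝ), p 1 + (g i).eval (p 0) = 0 → MvPolynomial.eval p Φ = 0 := by
    intro i p hp
    rw [hΦL, MvPolynomial.eval_prod]
    exact Finset.prod_eq_zero (Finset.mem_univ i) (by rw [hevalL]; exact hp)
  -- `H(Φ)` at a point of sheet `i`: `(∏_{j ≠ i} L_j)³ · H(L_i)`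
  have hHΦ : ∀ i (p : Fin 2 → ℝ), p 1 + (g i).eval (p 0) = 0 →
      MvPolynomial.eval p
        (MvPolynomial.X 0 * MvPolynomial.pderiv 0 (MvPolynomial.X 0 * MvPolynomial.pderiv 0 (Φ)) * (MvPolynomial.X 1 * MvPolynomial.pderiv 1 (Φ)) ^ 2
          - 2 * (MvPolynomial.X 0 * MvPolynomial.pderiv 0 (MvPolynomial.X 1 * MvPolynomial.pderiv 1 (Φ)))
            * (MvPolynomial.X 0 * MvPolynomial.pderiv 0 (Φ)) * (MvPolynomial.X 1 * MvPolynomial.pderiv 1 (Φ))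
          + MvPolynomial.X 1 * MvPolynomial.pderiv 1 (MvPolynomial.X 1 * MvPolynomial.pderiv 1 (Φ)) * (MvPolynomial.X 0 * MvPolynomial.pderiv 0 (Φ)) ^ 2) =
      MvPolynomial.eval p (∏ j ∈ Finset.univ.erase i, L j) ^ 3 * MvPolynomial.eval p
        (MvPolynomial.X 0 * MvPolynomial.pderiv 0 (MvPolynomial.X 0 * MvPolynomial.pderiv 0 (L i)) * (MvPolynomial.X 1 * MvPolynomial.pderiv 1 (L i)) ^ 2
          - 2 * (MvPolynomial.X 0 * MvPolynomial.pderiv 0 (MvPolynomial.X 1 * MvPolynomial.pderiv 1 (L i)))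
            * (MvPolynomial.X 0 * MvPolynomial.pderiv 0 (L i)) * (MvPolynomial.X 1 * MvPolynomial.pderiv 1 (L i))
          + MvPolynomial.X 1 * MvPolynomial.pderiv 1 (MvPolynomial.X 1 * MvPolynomial.pderiv 1 (L i)) * (MvPolynomial.X 0 * MvPolynomial.pderiv 0 (L i)) ^ 2) := by
    intro i p hp
    rw [hsplit i]
    exact OsculationGeneric.eval_logHessian_mul_of_eval_eq_zero (L i) _ p (by rw [hevalL]; exact hp)
  -- (1) a visible sheet has a nonzero log-Wronskian
  have hW : ∀ i (t₀ : ℝ), 0 < t₀ → (g i).eval t₀ < 0 →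
      g i * (X * derivative (X * derivative (g i))) - (X * derivative (g i)) ^ 2 ≠ 0 := by
    intro i t₀ ht₀ hgt hW0
    refine hfin.not_infinite (infinite_of_sheet_subset (g i) t₀ ht₀ hgt fun t ht hg => ?_)
    have hp : (![t, -(g i).eval t] : Fin 2 → ℝ) 1 + (g i).eval ((![t, -(g i).eval t] : Fin 2 → ℝ) 0) = 0 := by
      simp
    refine ⟨by simpa using ht, by simpa using hg, hevalΦ i _ hp, ?_⟩
    rw [hHΦ i _ hp, eval_logHessian_sheet_eq_zero_of_logWronskian (g i) _ hp (by rw [hW0, eval_zero]), mul_zero]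
  -- (2) two visible sheets are distinct polynomials
  have hne : ∀ i j, i ≠ j → ∀ t₀ : ℝ, 0 < t₀ → (g i).eval t₀ < 0 → g i - g j ≠ 0 := by
    intro i j hij t₀ ht₀ hgt h0
    have hgg : g j = g i := (sub_eq_zero.1 h0).symm
    refine hfin.not_infinite (infinite_of_sheet_subset (g i) t₀ ht₀ hgt fun t ht hg => ?_)
    have hp : (![t, -(g i).eval t] : Fin 2 → ℝ) 1 + (g i).eval ((![t, -(g i).eval t] : Fin 2 → ℝ) 0) = 0 := by
      simp
    refine ⟨by simpa using ht, by simpa using hg, hevalΦ i _ hp, ?_⟩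
    rw [hHΦ i _ hp, MvPolynomial.eval_prod,
      Finset.prod_eq_zero (Finset.mem_erase.2 ⟨hij.symm, Finset.mem_univ j⟩) (by rw [hevalL, hgg]; exact hp)]
    ring
  -- (3) the cover
  set f : Fin r → ℝ → (Fin 2 → ℝ) := fun i t => ![t, -(g i).eval t] with hf
  set A : Fin r → Finset (Fin 2 → ℝ) := fun i =>
    ((g i * (X * derivative (X * derivative (g i))) - (X * derivative (g i)) ^ 2).roots.toFinset.filter
      (fun t => 0 < t)).image (f i) with hA
  set B : Fin r → Fin r → Finset (Fin 2 → ℝ) := fun i j =>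
    ((g i - g j).roots.toFinset.filter (fun t => 0 < t)).image (f i) with hB
  set F : Finset (Fin 2 → ℝ) :=
    Finset.univ.biUnion (fun i => A i ∪ (Finset.Ioi i).biUnion (fun j => B i j)) with hF
  have hcover : O ⊆ ↑F := by
    intro p hp
    obtain ⟨ht, hb, hΦ0, hH0⟩ := hp
    -- some sheet vanishes at `p`
    have hex : ∃ i, p 1 + (g i).eval (p 0) = 0 := by
      rw [hΦL, MvPolynomial.eval_prod, Finset.prod_eq_zero_iff] at hΦ0
      obtain ⟨i, -, hi⟩ := hΦ0
      exact ⟨i, by rw [← hevalL]; exact hi⟩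
    -- the smallest such sheet
    set S : Finset (Fin r) := Finset.univ.filter (fun i => p 1 + (g i).eval (p 0) = 0) with hS
    have hSne : S.Nonempty := by
      obtain ⟨i, hi⟩ := hex
      exact ⟨i, Finset.mem_filter.2 ⟨Finset.mem_univ i, hi⟩⟩
    set i := S.min' hSne with hi
    have hiS : p 1 + (g i).eval (p 0) = 0 := (Finset.mem_filter.1 (Finset.min'_mem S hSne)).2
    have hvis : (g i).eval (p 0) < 0 := by linarith
    have hpf : p = f i (p 0) := by
      rw [hf]; ext k; fin_cases k
      · rfl
      · simp only [Fin.mk_one, Matrix.cons_val_one, Matrix.cons_val_zero]; linarith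
    rw [Finset.mem_coe, hF, Finset.mem_biUnion]
    refine ⟨i, Finset.mem_univ i, ?_⟩
    rw [Finset.mem_union]
    by_cases hex2 : ∃ j, j ≠ i ∧ p 1 + (g j).eval (p 0) = 0
    · -- a second sheet: `p` is a crossing point
      obtain ⟨j, hji, hj⟩ := hex2
      have hjS : j ∈ S := Finset.mem_filter.2 ⟨Finset.mem_univ j, hj⟩
      have hij : i < j := lt_of_le_of_ne (Finset.min'_le S j hjS) (Ne.symm hji)
      refine Or.inr (Finset.mem_biUnion.2 ⟨j, Finset.mem_Ioi.2 hij, ?_⟩)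
      rw [hB, Finset.mem_image]
      refine ⟨p 0, Finset.mem_filter.2 ⟨?_, ht⟩, hpf.symm⟩
      rw [Multiset.mem_toFinset, mem_roots (hne i j (ne_of_lt hij) (p 0) ht hvis), IsRoot.def, eval_sub]
      linarith
    · -- a single sheet: `p 0` is a root of the log-Wronskian
      push Not at hex2
      have hM : MvPolynomial.eval p (∏ j ∈ Finset.univ.erase i, L j) ≠ 0 := by
        rw [MvPolynomial.eval_prod, Finset.prod_ne_zero_iff]
        intro j hj
        rw [hevalL]
        exact hex2 j (Finset.mem_erase.1 hj).1
      have hHi : MvPolynomial.eval p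
          (MvPolynomial.X 0 * MvPolynomial.pderiv 0 (MvPolynomial.X 0 * MvPolynomial.pderiv 0 (L i)) * (MvPolynomial.X 1 * MvPolynomial.pderiv 1 (L i)) ^ 2
          - 2 * (MvPolynomial.X 0 * MvPolynomial.pderiv 0 (MvPolynomial.X 1 * MvPolynomial.pderiv 1 (L i)))
            * (MvPolynomial.X 0 * MvPolynomial.pderiv 0 (L i)) * (MvPolynomial.X 1 * MvPolynomial.pderiv 1 (L i))
          + MvPolynomial.X 1 * MvPolynomial.pderiv 1 (MvPolynomial.X 1 * MvPolynomial.pderiv 1 (L i)) * (MvPolynomial.X 0 * MvPolynomial.pderiv 0 (L i)) ^ 2) = 0 := by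
        have h := hH0
        rw [hHΦ i p hiS] at h
        exact (mul_eq_zero.1 h).resolve_left (pow_ne_zero 3 hM)
      refine Or.inl ?_
      rw [hA, Finset.mem_image]
      refine ⟨p 0, Finset.mem_filter.2 ⟨?_, ht⟩, hpf.symm⟩
      rw [Multiset.mem_toFinset, mem_roots (hW i (p 0) ht hvis), IsRoot.def]
      exact logWronskian_root_of_sheet (g i) p hb.ne' hiS hHi
  -- (4) the count
  have hAcard : ∀ i, (A i).card ≤ E.card.choose 2 - 1 := by
    intro i
    rw [hA]
    refine Finset.card_image_le.trans ?_
    by_cases h0 : g i * (X * derivative (X * derivative (g i))) - (X * derivative (g i)) ^ 2 = 0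
    · rw [h0, roots_zero, Multiset.toFinset_zero, Finset.filter_empty, Finset.card_empty]
      exact Nat.zero_le _
    · exact (card_posRoots_le h0).trans (Nat.sub_le_sub_right (card_support_logWronskian_le (hE i)) 1)
  have hBcard : ∀ i j, (B i j).card ≤ E.card - 1 := by
    intro i j
    rw [hB]
    refine Finset.card_image_le.trans ?_
    by_cases h0 : g i - g j = 0
    · rw [h0, roots_zero, Multiset.toFinset_zero, Finset.filter_empty, Finset.card_empty]
      exact Nat.zero_le _
    · exact (card_posRoots_le h0).trans (Nat.sub_le_sub_right (card_support_sub_le (hE i) (hE j)) 1)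
  have hFcard : F.card ≤ r * (E.card.choose 2 - 1) + r.choose 2 * (E.card - 1) := by
    rw [hF]
    refine Finset.card_biUnion_le.trans ?_
    calc ∑ i, (A i ∪ (Finset.Ioi i).biUnion (fun j => B i j)).card
        ≤ ∑ i : Fin r, ((E.card.choose 2 - 1) + (Finset.Ioi i).card * (E.card - 1)) := by
          refine Finset.sum_le_sum fun i _ => (Finset.card_union_le _ _).trans (Nat.add_le_add (hAcard i) ?_)
          refine Finset.card_biUnion_le.trans ?_
          rw [← smul_eq_mul, ← Finset.sum_const]
          exact Finset.sum_le_sum fun j _ => hBcard i j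
      _ = r * (E.card.choose 2 - 1) + r.choose 2 * (E.card - 1) := by
          rw [Finset.sum_add_distrib, Finset.sum_const, Finset.card_univ, Fintype.card_fin, smul_eq_mul,
            ← Finset.sum_mul, sum_card_Ioi_fin]
  calc O.ncard ≤ (↑F : Set (Fin 2 → ℝ)).ncard := Set.ncard_le_ncard hcover F.finite_toSet
    _ = F.card := Set.ncard_coe_finset F
    _ ≤ _ := hFcard

end OsculationCommuting

end Summit.ValiantsHypothesis.ValiantsHypothesis.Theorems.LacunarySymmetroidMatrixDescartes

end
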